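import Mathlib
import Summits.KontsevichZagierPeriods.KontsevichZagierPeriods.Theorems.SoloInformedAlgBoxSplit
import HarnessLib
import HarnessLib.Audit

/-!
# SoloInformed — PRES-RAT(1), the piece lemma: an interval piece of a rational one-variable representation is presentable

Solo programme `solo-KontsevichZagierPeriods-informed`, session s109.  The local step of
PRES-RAT(1) (file `SoloInformedPresRatOne`): let `r = (σ, P/Q)` be an integral representation of
dimension one with univariate rational integrand, `P, Q ∈ ℚ[X]`, `Q ≠ 0` on `σ`, and let
`(u, v) ⊆ σ` be an open interval with real algebraic end points.  Then `[(u, v), P/Q]` is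
presentable (`soloInformed_presentable_restrict_interval`).

Proof.  Write `P/Q = P₁/Q₁` in lowest terms over `ℚ[X]` (`soloInformed_lowestTerms`); absolute
convergence forces `Q₁` to have NO zero on the CLOSED interval `[u, v]` ("no poles to separate in
dimension one", `soloInformed_aeval_ne_zero_of_isCoprime` from
`KZ.rootMultiplicity_le_of_integrableOn`, Viu-Sos 2021 §2.3), so the affine chart
`s ↦ u + (v − u)s` of the piece (rule (2), the scale move `soloInformedScaleMoveR 0 u (v − u)`,
`soloInformed_image_scaleMoveR_one`) pulls the integrand back to the `K`-rational function
`(v − u) P₁(u + (v − u)s) / Q₁(u + (v − u)s)`, `K ⊂ ℝ` the real algebraic numbers, WITHOUT pole on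
`[0, 1]`: a cube germ (`soloInformedRationalGermK`), and the Nash-image lemma
(`soloInformed_presentable_of_nashImage`) presents the piece.  Also here: the two unbounded bands
of a cylindrical decomposition of the line (`soloInformed_band_zero_not_isBounded`,
`soloInformed_band_last_not_isBounded`), used by the global step.

References: J. Viu-Sos, Int. J. Number Theory 17 (2021), §2.3 (first paragraph);
M. Kontsevich, D. Zagier, *Periods* (2001), §1.2, rule (2); Basu–Pollack–Roy 2006, Def. 5.1.
-/

noncomputable section

open scoped BigOperators Topology Polynomial
open MeasureTheory Set Filter
open Literature.ModelTheory.ExponentialFields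
open Literature.NumberTheory.Transcendental Literature.NumberTheory.Transcendental.KZ

namespace Summit.KontsevichZagierPeriods.KontsevichZagierPeriods.Theorems

/-! ### Lowest terms over `ℚ[X]` and the absence of poles -/

/-- **Lowest terms.** For `P, Q ∈ ℚ[X]`, `Q ≠ 0`, with `g = gcd(P, Q)`, `P₁ = P/g`, `Q₁ = Q/g`:
`P₁, Q₁` are coprime, `Q₁ ≠ 0`, and at every real point where `Q` does not vanish `Q₁` does not
vanish and `P/Q = P₁/Q₁`. [folklore] -/
theorem soloInformed_lowestTerms (P Q : ℚ[X]) (hQ : Q ≠ 0) :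
    IsCoprime (P / GCDMonoid.gcd P Q) (Q / GCDMonoid.gcd P Q) ∧ Q / GCDMonoid.gcd P Q ≠ 0 ∧
    ∀ t : ℝ, (Polynomial.aeval t Q : ℝ) ≠ 0 →
      (Polynomial.aeval t (Q / GCDMonoid.gcd P Q) : ℝ) ≠ 0 ∧
      (Polynomial.aeval t P : ℝ) / Polynomial.aeval t Q =
        Polynomial.aeval t (P / GCDMonoid.gcd P Q) / Polynomial.aeval t (Q / GCDMonoid.gcd P Q) := by
  set g := GCDMonoid.gcd P Q with hg
  have hg0 : g ≠ 0 := fun h => hQ ((gcd_eq_zero_iff P Q).1 h).2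
  have hPg : g * (P / g) = P := EuclideanDomain.mul_div_cancel' hg0 (GCDMonoid.gcd_dvd_left P Q)
  have hQg : g * (Q / g) = Q := EuclideanDomain.mul_div_cancel' hg0 (GCDMonoid.gcd_dvd_right P Q)
  refine ⟨isCoprime_div_gcd_div_gcd hQ, right_div_gcd_ne_zero hQ, fun t ht => ?_⟩
  have hQt : (Polynomial.aeval t Q : ℝ) = Polynomial.aeval t g * Polynomial.aeval t (Q / g) := by
    conv_lhs => rw [← hQg]
    rw [map_mul]
  have hPt : (Polynomial.aeval t P : ℝ) = Polynomial.aeval t g * Polynomial.aeval t (P / g) := by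
    conv_lhs => rw [← hPg]
    rw [map_mul]
  rw [hQt] at ht
  refine ⟨right_ne_zero_of_mul ht, ?_⟩
  rw [hPt, hQt, mul_div_mul_left _ _ (left_ne_zero_of_mul ht)]

/-- **No integrable pole in one variable (coprime form).** If `P₁, Q₁ ∈ ℚ[X]` are coprime,
`Q₁ ≠ 0`, and `P₁/Q₁` is integrable on `(u, v)` (`u < v`), then `Q₁` has no zero on the CLOSED
interval `[u, v]`: at a zero `a` of `Q₁` the coprime numerator does not vanish, and a pole of
order `≥ 1` is not integrable (`KZ.rootMultiplicity_le_of_integrableOn`).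
[Viu-Sos 2021, §2.3, first paragraph] -/
theorem soloInformed_aeval_ne_zero_of_isCoprime {P₁ Q₁ : ℚ[X]} (hcop : IsCoprime P₁ Q₁)
    (hQ₁ : Q₁ ≠ 0) {u v a : ℝ} (huv : u < v) (ha : a ∈ Icc u v)
    (hint : IntegrableOn (fun t : ℝ => (Polynomial.aeval t P₁ : ℝ) / Polynomial.aeval t Q₁)
      (Ioo u v)) :
    (Polynomial.aeval a Q₁ : ℝ) ≠ 0 := by
  have hev : ∀ (F : ℚ[X]) (t : ℝ), (Polynomial.aeval t F : ℝ) = (F.map (algebraMap ℚ ℝ)).eval t :=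
    fun F t => by rw [Polynomial.eval_map, Polynomial.aeval_def]
  set P := P₁.map (algebraMap ℚ ℝ) with hP
  set Q := Q₁.map (algebraMap ℚ ℝ) with hQ
  have hinj : Function.Injective (algebraMap ℚ ℝ) := (algebraMap ℚ ℝ).injective
  have hcop' : IsCoprime P Q := by
    simpa only [Polynomial.coe_mapRingHom] using hcop.map (Polynomial.mapRingHom (algebraMap ℚ ℝ))
  have hQ0 : Q ≠ 0 := fun h => hQ₁ ((Polynomial.map_eq_zero_iff hinj).1 h)
  intro hQa
  rw [hev] at hQa
  by_cases hP0 : P = 0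
  · -- `P₁ = 0`: the coprime `Q₁` is a unit, a non-zero constant
    have hP₁ : P₁ = 0 := (Polynomial.map_eq_zero_iff hinj).1 hP0
    rw [hP₁, isCoprime_zero_left] at hcop
    obtain ⟨c, hc, hcQ⟩ := Polynomial.isUnit_iff.1 hcop
    rw [← hcQ, Polynomial.map_C, Polynomial.eval_C] at hQa
    exact hc.ne_zero (hinj (by rw [hQa, map_zero]))
  · have hint' : IntegrableOn (fun t => P.eval t / Q.eval t) (Ioo u v) :=
      hint.congr_fun (fun t _ => by
        simp only [hP, hQ, hev]) measurableSet_Ioo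
    have hle := KZ.rootMultiplicity_le_of_integrableOn hP0 hQ0 huv ha hint'
    have hQpos : 0 < Q.rootMultiplicity a := (Polynomial.rootMultiplicity_pos hQ0).2 hQa
    have hPa : P.eval a = 0 := (Polynomial.rootMultiplicity_pos hP0).1 (hQpos.trans_le hle)
    obtain ⟨s, t, hst⟩ := hcop'
    have h1 := congrArg (Polynomial.eval a) hst
    rw [Polynomial.eval_add, Polynomial.eval_mul, Polynomial.eval_mul, hPa, Polynomial.eval_one]
      at h1
    have hQa' : Polynomial.eval a Q = 0 := hQa
    rw [hQa'] at h1
    norm_num at h1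

/-- The affine chart of an interval: the scale move `x₀ ↦ u + (v − u)·x₀` maps the open unit
interval onto `(u, v)`. -/
theorem soloInformed_image_scaleMoveR_one {u v : ℝ} (huv : u < v) :
    soloInformedScaleMoveR (n := 1) 0 u (v - u) '' soloInformedOpenCube 1 =
      {w : Fin 1 → ℝ | ∀ i, u < w i ∧ w i < v} := by
  have hβ : 0 < v - u := sub_pos.2 huv
  ext w
  simp only [mem_image, soloInformed_mem_openCube_iff, mem_setOf_eq]
  constructor
  · rintro ⟨x, hx, rfl⟩ i
    rw [Subsingleton.elim i 0, soloInformed_scaleMoveR_apply_self]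
    obtain ⟨h0, h1⟩ := hx 0
    constructor <;> nlinarith
  · intro hw
    obtain ⟨hw0, hw1⟩ := hw 0
    refine ⟨fun _ => (w 0 - u) * (v - u)⁻¹, fun i => ⟨mul_pos (sub_pos.2 hw0) (inv_pos.2 hβ), ?_⟩,
      ?_⟩
    · rw [← div_eq_mul_inv, div_lt_one hβ]
      linarith
    · funext i
      rw [Subsingleton.elim i 0, soloInformed_scaleMoveR_apply_self]
      show u + (v - u) * ((w 0 - u) * (v - u)⁻¹) = w 0
      rw [mul_comm (v - u), mul_assoc, inv_mul_cancel₀ hβ.ne', mul_one]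
      ring

/-! ### Unbounded bands of a cylindrical decomposition of the line -/

/-- The lowest band over the point is unbounded. [Basu–Pollack–Roy 2006, Def. 5.1] -/
theorem soloInformed_band_zero_not_isBounded {L : ℕ} (ξ : Fin L → (Fin 0 → ℝ) → ℝ) :
    ¬ Bornology.IsBounded (bandOver univ ξ 0) := by
  intro h
  obtain ⟨C, hC⟩ := isBounded_iff_forall_norm_le.mp h
  obtain ⟨t, htC, ht⟩ : ∃ t : ℝ, C < |t| ∧
      (t : EReal) < bandUpper ξ 0 (Fin.elim0 : Fin 0 → ℝ) := by
    by_cases hl : (0 : Fin (L + 1)) = Fin.last L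
    · refine ⟨-(|C| + 1), ?_, by rw [hl, bandUpper_last]; exact EReal.coe_lt_top _⟩
      rw [abs_neg, abs_of_pos (by positivity)]
      linarith [le_abs_self C]
    · set r := ξ ((0 : Fin (L + 1)).castPred hl) Fin.elim0 with hr
      have h1 : min r 0 - (|C| + 1) < 0 := by linarith [min_le_right r 0, abs_nonneg C]
      refine ⟨min r 0 - (|C| + 1), ?_, ?_⟩
      · rw [abs_of_neg h1]
        linarith [le_abs_self C, min_le_right r 0]
      · rw [bandUpper_of_ne_last ξ 0 hl, EReal.coe_lt_coe_iff]
        linarith [min_le_left r 0, abs_nonneg C]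
  have hmem : (fun _ => t : Fin 1 → ℝ) ∈ bandOver univ ξ 0 := by
    rw [mem_bandOver_iff]
    refine ⟨mem_univ _, by simp, ?_⟩
    rwa [Subsingleton.elim (Fin.init fun _ : Fin 1 => t) Fin.elim0]
  have h2 : ‖t‖ ≤ C := (norm_le_pi_norm (fun _ : Fin 1 => t) 0).trans (hC _ hmem)
  rw [Real.norm_eq_abs] at h2
  linarith

/-- The highest band over the point is unbounded. [Basu–Pollack–Roy 2006, Def. 5.1] -/
theorem soloInformed_band_last_not_isBounded {L : ℕ} (ξ : Fin L → (Fin 0 → ℝ) → ℝ) :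
    ¬ Bornology.IsBounded (bandOver univ ξ (Fin.last L)) := by
  intro h
  obtain ⟨C, hC⟩ := isBounded_iff_forall_norm_le.mp h
  obtain ⟨t, htC, ht⟩ : ∃ t : ℝ, C < |t| ∧
      bandLower ξ (Fin.last L) (Fin.elim0 : Fin 0 → ℝ) < (t : EReal) := by
    by_cases h0 : Fin.last L = 0
    · refine ⟨|C| + 1, ?_, by rw [h0, bandLower_zero]; exact EReal.bot_lt_coe _⟩
      rw [abs_of_pos (by positivity)]
      linarith [le_abs_self C]
    · set r := ξ ((Fin.last L).pred h0) Fin.elim0 with hr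
      have h1 : 0 < max r 0 + (|C| + 1) := by linarith [le_max_right r 0, abs_nonneg C]
      refine ⟨max r 0 + (|C| + 1), ?_, ?_⟩
      · rw [abs_of_pos h1]
        linarith [le_abs_self C, le_max_right r 0]
      · rw [bandLower_of_ne_zero ξ (Fin.last L) h0, EReal.coe_lt_coe_iff]
        linarith [le_max_left r 0, abs_nonneg C]
  have hmem : (fun _ => t : Fin 1 → ℝ) ∈ bandOver univ ξ (Fin.last L) := by
    rw [mem_bandOver_iff]
    refine ⟨mem_univ _, ?_, by simp [bandUpper]⟩
    rwa [Subsingleton.elim (Fin.init fun _ : Fin 1 => t) Fin.elim0]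
  have h2 : ‖t‖ ≤ C := (norm_le_pi_norm (fun _ : Fin 1 => t) 0).trans (hC _ hmem)
  rw [Real.norm_eq_abs] at h2
  linarith

/-! ### The piece lemma: an interval piece of a rational representation is presentable -/

/-- **The piece lemma.** Let `r = (σ, P/Q)` be a representation of dimension one whose integrand
is the univariate rational function `P(x₀)/Q(x₀)`, `P, Q ∈ ℚ[X]`, `Q ≠ 0` on `σ`, and let
`(u, v) ⊆ σ` be an open interval with real algebraic end points `u < v`.  Then the restriction
`[(u, v), P/Q]` is presentable: in lowest terms `P₁/Q₁` the denominator has no zero on `[u, v]`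
(absolute convergence), so the pull-back `(v − u)·P₁(u + (v − u)s)/Q₁(u + (v − u)s)` by the
affine chart of the piece is a pole-free `K`-rational cube germ (`K` the real algebraic numbers)
whose real part presents the piece by the Nash-image lemma.
[Viu-Sos 2021, §2.3; Kontsevich–Zagier 2001, §1.2, rule (2)] -/
theorem soloInformed_presentable_restrict_interval (r : IntegralRep 1) {P Q : ℚ[X]}
    (hq : ∀ x ∈ r.domain, (Polynomial.aeval (x 0) Q : ℝ) ≠ 0)
    (hpq : EqOn r.integrand
      (fun x => (Polynomial.aeval (x 0) P : ℝ) / Polynomial.aeval (x 0) Q) r.domain)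
    {u v : ℝ} (huv : u < v) (hu : IsAlgebraic ℚ u) (hv : IsAlgebraic ℚ v)
    (hI : IsSemialgebraic ℚ {w : Fin 1 → ℝ | ∀ i, u < w i ∧ w i < v})
    (hsub : {w : Fin 1 → ℝ | ∀ i, u < w i ∧ w i < v} ⊆ r.domain) :
    of (r.restrict _ hI hsub) ∈ soloInformedPresentable := by
  -- the real algebraic coefficient field `K = algebraicClosure ℚ ℝ`
  have hK := soloInformed_algCoeff_algebraicClosure
  haveI : CharZero (algebraicClosure ℚ ℝ) := soloInformed_charZero_of_embedding _
  set uK : algebraicClosure ℚ ℝ := ⟨u, mem_algebraicClosure_iff.2 hu⟩ with huK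
  set vK : algebraicClosure ℚ ℝ := ⟨v, mem_algebraicClosure_iff.2 hv⟩ with hvK
  have huK' : algebraMap (algebraicClosure ℚ ℝ) ℝ uK = u := rfl
  have hvK' : algebraMap (algebraicClosure ℚ ℝ) ℝ vK = v := rfl
  have hβ : 0 < v - u := sub_pos.2 huv
  -- lowest terms
  obtain ⟨x₀, hx₀⟩ : ∃ x₀ : Fin 1 → ℝ, x₀ ∈ {w : Fin 1 → ℝ | ∀ i, u < w i ∧ w i < v} :=
    ⟨fun _ => (u + v) / 2, fun i => ⟨by linarith, by linarith⟩⟩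
  have hQ0 : Q ≠ 0 := by
    intro h
    apply hq x₀ (hsub hx₀)
    rw [h, map_zero]
  obtain ⟨hcop, hQ₁0, hred⟩ := soloInformed_lowestTerms P Q hQ0
  set P₁ := P / GCDMonoid.gcd P Q with hP₁
  set Q₁ := Q / GCDMonoid.gcd P Q with hQ₁
  -- `Q` does not vanish on `(u, v)`, and there `P/Q = P₁/Q₁`
  have hQt : ∀ t ∈ Ioo u v, (Polynomial.aeval t Q : ℝ) ≠ 0 := fun t ht =>
    hq (fun _ => t) (hsub fun i => ht)
  -- integrability of `P₁/Q₁` on `(u, v)`, read on the real line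
  have hint : IntegrableOn (fun t : ℝ => (Polynomial.aeval t P₁ : ℝ) / Polynomial.aeval t Q₁)
      (Ioo u v) := by
    set e : ℝ → (Fin 1 → ℝ) := fun t _ => t with he
    set Φ₁ := MeasurableEquiv.funUnique (Fin 1) ℝ with hΦ₁
    have hΦe : ⇑Φ₁.symm = e := by
      funext t i
      rw [hΦ₁, MeasurableEquiv.funUnique_symm_apply]
      exact uniqueElim_const t i
    have h := ((volume_preserving_funUnique (Fin 1) ℝ).symm Φ₁).integrableOn_comp_preimage
      Φ₁.symm.measurableEmbedding (f := r.integrand) (s := r.domain)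
    rw [hΦe] at h
    have hA : IntegrableOn (r.integrand ∘ e) (e ⁻¹' r.domain) := h.mpr r.integrableOn
    have hsubA : Ioo u v ⊆ e ⁻¹' r.domain := fun t ht => hsub fun i => ht
    refine (hA.mono_set hsubA).congr_fun (fun t ht => ?_) measurableSet_Ioo
    have hmem : e t ∈ r.domain := hsubA ht
    show r.integrand (e t) = _
    rw [hpq hmem]
    show (Polynomial.aeval t P : ℝ) / Polynomial.aeval t Q = _
    exact (hred t (hQt t ht)).2
  -- hence `Q₁` has no zero on `[u, v]`
  have hQ₁ne : ∀ a ∈ Icc u v, (Polynomial.aeval a Q₁ : ℝ) ≠ 0 := fun a ha =>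
    soloInformed_aeval_ne_zero_of_isCoprime hcop hQ₁0 huv ha hint
  -- the affine substitution `X ↦ u + (v - u)·X₀` from `ℚ[X]` into `K[X₀]`
  set σK : ℚ[X] → MvPolynomial (Fin 1) (algebraicClosure ℚ ℝ) := fun F =>
    F.eval₂ (MvPolynomial.C.comp (Rat.castHom (algebraicClosure ℚ ℝ)))
      (MvPolynomial.C uK + MvPolynomial.C (vK - uK) * MvPolynomial.X 0) with hσK
  have hσK_eval : ∀ (F : ℚ[X]) (x : Fin 1 → ℝ), (MvPolynomial.aeval x (σK F) : ℝ) =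
      Polynomial.aeval (u + (v - u) * x 0) F := fun F x => by
    have hφ : ((MvPolynomial.aeval x :
        MvPolynomial (Fin 1) (algebraicClosure ℚ ℝ) →ₐ[algebraicClosure ℚ ℝ] ℝ).toRingHom.comp
        (MvPolynomial.C.comp (Rat.castHom (algebraicClosure ℚ ℝ)))) = algebraMap ℚ ℝ :=
      Subsingleton.elim _ _
    have h := Polynomial.hom_eval₂ (p := F)
      (f := MvPolynomial.C.comp (Rat.castHom (algebraicClosure ℚ ℝ)))
      (g := (MvPolynomial.aeval x :
        MvPolynomial (Fin 1) (algebraicClosure ℚ ℝ) →ₐ[algebraicClosure ℚ ℝ] ℝ).toRingHom)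
      (x := MvPolynomial.C uK + MvPolynomial.C (vK - uK) * MvPolynomial.X 0)
    rw [hφ] at h
    have hy : (MvPolynomial.aeval x :
        MvPolynomial (Fin 1) (algebraicClosure ℚ ℝ) →ₐ[algebraicClosure ℚ ℝ] ℝ).toRingHom
        (MvPolynomial.C uK + MvPolynomial.C (vK - uK) * MvPolynomial.X 0) =
        u + (v - u) * x 0 := by
      simp only [AlgHom.toRingHom_eq_coe, RingHom.coe_coe, map_add, map_mul, MvPolynomial.aeval_C,
        MvPolynomial.aeval_X, map_sub, huK', hvK']
    rw [hy, ← Polynomial.aeval_def] at h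
    exact h
  -- the pulled-back `K`-rational function and its cube germ
  set pK : MvPolynomial (Fin 1) (algebraicClosure ℚ ℝ) := MvPolynomial.C (vK - uK) * σK P₁ with hpK
  set qK : MvPolynomial (Fin 1) (algebraicClosure ℚ ℝ) := σK Q₁ with hqK
  have hqK_eval : ∀ x : Fin 1 → ℝ, (MvPolynomial.aeval x qK : ℝ) =
      Polynomial.aeval (u + (v - u) * x 0) Q₁ := fun x => by
    rw [hqK, hσK_eval]
  have hpK_eval : ∀ x : Fin 1 → ℝ, (MvPolynomial.aeval x pK : ℝ) =
      (v - u) * Polynomial.aeval (u + (v - u) * x 0) P₁ := fun x => by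
    rw [hpK, map_mul, MvPolynomial.aeval_C, hσK_eval, map_sub, huK', hvK']
  have hqKne : ∀ x ∈ soloInformedCube 1, (MvPolynomial.aeval x qK : ℝ) ≠ 0 := fun x hx => by
    rw [hqK_eval]
    obtain ⟨h0, h1⟩ := soloInformed_mem_cube_iff.1 hx 0
    refine hQ₁ne _ ⟨?_, ?_⟩ <;> nlinarith
  set G : SoloInformedCubeGerm 1 := soloInformedRationalGermK hK pK qK hqKne with hG
  -- the affine chart of the piece: the scale move `x₀ ↦ u + (v - u) x₀` with coefficients in `K`
  have hΦs : IsSemialgebraicMapOn ℚ (soloInformedOpenCube 1)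
      (soloInformedScaleMoveR (n := 1) 0 u (v - u)) := by
    have h := soloInformed_isSemialgebraicMapOn_scaleMoveK hK (0 : Fin 1) uK (vK - uK)
      (isSemialgebraic_soloInformedOpenCube 1)
    rw [map_sub, huK', hvK'] at h
    exact h
  refine soloInformed_presentable_of_nashImage _ (soloInformedScaleMoveR (n := 1) 0 u (v - u))
    (fun _ => soloInformedScaleDerivR (n := 1) 0 (v - u)) G hΦs
    (fun x _ => (soloInformed_hasFDerivAt_scaleMoveR (n := 1) 0 u (v - u) x).hasFDerivWithinAt)
    (soloInformed_scaleMoveR_injective (n := 1) 0 hβ.ne').injOn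
    (by rw [IntegralRep.domain_restrict, soloInformed_image_scaleMoveR_one huv]) fun x hx => ?_
  -- the Jacobian identity on the open cube
  have hx0 : 0 < x 0 ∧ x 0 < 1 := soloInformed_mem_openCube_iff.1 hx 0
  have hΦ0 : soloInformedScaleMoveR (n := 1) 0 u (v - u) x 0 = u + (v - u) * x 0 :=
    soloInformed_scaleMoveR_apply_self _ _ _ _
  have ht : u + (v - u) * x 0 ∈ Ioo u v := ⟨by nlinarith, by nlinarith⟩
  have hmem : soloInformedScaleMoveR (n := 1) 0 u (v - u) x ∈ r.domain := by
    refine hsub fun i => ?_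
    rw [Subsingleton.elim i 0, hΦ0]
    exact ht
  rw [hG, soloInformedRationalGermK_g_re, hpK_eval, hqK_eval, IntegralRep.integrand_restrict,
    hpq hmem]
  dsimp only
  rw [hΦ0, (hred _ (hQt _ ht)).2, soloInformed_det_scaleDerivR, abs_of_pos hβ]
  ring

end Summit.KontsevichZagierPeriods.KontsevichZagierPeriods.Theorems
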